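import Literature.AlgebraicGeometry.HodgeTheory.FermatHodgeCharactersPrimePow
import HarnessLib

/-!
# Cube relations for Hodge multisets: the unit part of Aoki's `τ₁(α) ∈ A(m)` via Koblitz–Ogus

Topic `Literature/AlgebraicGeometry/HodgeTheory`. THEOREMS only (no definition of record, no named fact, no `sorry`).
For Shioda's Hodge multisets `s` over `ℤ/m` (`FermatCharacter.IsHodgeMultiset`, [Shioda1979PJA, §1 (2), (3)]) write
`o(w) = #_w s − #_{−w} s` for the odd part of the multiplicity function. A **cube** at `y ∈ ℤ/m` is given by shifts
`δ₁, …, δ_k ∈ ℤ/m` such that every PROPER divisor `M` of `m` divides (the representative of) some `δ_i` — e.g. one shift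
`δ_p ∈ (m/p)ℤ` for each prime `p ∣ m` — and such that all `2ᵏ` vertices `y_A = y + Σ_{i ∈ A} δ_i` (`A ⊆ {1, …, k}`) are
prime to `m`. THEN (`IsHodgeMultiset.cube_relation`)

  `Σ_A (−1)^{#A} o(y_A) = 0.`

Instances: `k = 2` at the levels `2ᵃ3ᵇ` (`δ = (m/2, c·m/3)`) is the class relation / hexagon of
`Shioda1982.HodgeQuadruplesTwoThreePower` (`countSub_class_twoThreePower`); `k = 2` at the levels `2ᵃ·p` is the class relation of
`Shioda1982.PicardNumberTwoPowerPrime`; the present file states the relation ONCE for every level and every admissible system of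
shifts, with the explicit `4`-term (`cube_relation_two`) and `8`-term (`cube_relation_three`) forms for the users (cell
`pub-hfermat`, LIT lane: the levels `2ᵃ3ᵇ·5`, `2ᵃ3ᵇ·7`, `2ᵃ3ᵇ·35` of [Aoki1983, Thm. C]).

PROOF (this formalisation's lemma; the span statement is Koblitz–Ogus [Deligne1982HodgeCycles, Rem. 7.16 (a)], in the tree as
`KoblitzOgus.hodge_eq_combination`: the multiplicity function of a Hodge multiset is a rational combination of the
negation-invariant point masses and of the distribution vectors `D_{M,z} = [· ≡ z (mod M)] − [· = (m/M)z]`, `M ∣ m`). The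
functional `L(g) = Σ_A (−1)^{#A} (g(y_A) − g(−y_A))` kills negation-invariant `g`; it kills `D_{m,z} = 0`; for a proper
divisor `M` the point `(m/M)z` is not prime to `m` (so it is none of the units `±y_A`), and the congruence indicator
`[· ≡ z (mod M)]` takes the same value at `±y_A` and `±y_{A △ {i}}` for an `i` with `M ∣ δ_i`, so the terms of `L` cancel in
pairs under the involution `A ↦ A △ {i}`. In Aoki's language [Aoki1983, p. 28, Prop. 2.2]: the unit part `τ₁(α)` of
`α ∈ B_m` is annihilated by every PRIMITIVE odd character of conductor `m`, and the cube functions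
`Σ_A (−1)^{#A} ([· = y_A] − [· = −y_A])` are annihilated by every imprimitive and every even character.

Cross-checks outside Lean (cell `pub-hfermat`, `pub-hfermat-lit` g40 `num/relsim2.py`, `num/cubetest.py`): every cube relation
holds on every Hodge `4`-multiset of the levels `144, 240, 320, 360, 448, 480, 640, 720` (`0` violations); at `720` the cube
relations alone reduce a pair-free `4`-set containing the unit `1` to `γ₁`, a twin `{1, 361, z, w}`, or one sporadic non-Hodge
configuration.

HONEST FRAMING (cell `pub-hfermat`): explicit algebraic cycles for specific Hodge classes on Fermat/Delsarte varieties; residual open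
instances listed; no claim on general Hodge. (A linear identity for Shioda's Hodge condition; no cycle is constructed here.)

## References
* [Deligne1982HodgeCycles] P. Deligne, *Hodge cycles on abelian varieties*, LNM 900 (1982), Rem. 7.16 (a) (Koblitz–Ogus).
* [Aoki1983] N. Aoki, *On some arithmetic problems related to the Hodge cycles on the Fermat varieties*, Math. Ann. 266 (1983)
  23–54, p. 28 (`A(m)`, `τ_d`), Prop. 2.2 p. 29.
* [Shioda1979PJA] T. Shioda, Proc. Japan Acad. 55A (1979) 111–114, §1 eqs. (2), (3).
-/

namespace Literature.AlgebraicGeometry.HodgeTheory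

namespace FermatCharacter

open Finset Multiset

variable {m : ℕ} [NeZero m]

section CubeRelations

/-! ### The Koblitz–Ogus bridge: functionals killing the distribution vectors kill the multiplicity function -/

/-- The Koblitz–Ogus distribution vector of level `M ∣ m` through `z`: `w ↦ [w ≡ z (mod M)] − [(m/M)·z = w]`.
[cite: Deligne1982HodgeCycles, Rem. 7.16 (a)] -/
private def koVec (m : ℕ) (M : ℕ) (z w : ZMod m) : ℚ :=
  (if w.val % M = z.val % M then (1 : ℚ) else 0) - (if ((m / M : ℕ) : ZMod m) * z = w then 1 else 0)

/-- **The bridge from Koblitz–Ogus to count identities.** A linear functional on functions `ℤ/m → ℚ` that kills the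
negation-invariant functions and every distribution vector kills the multiplicity function of a Hodge multiset.
[cite: Deligne1982HodgeCycles, Rem. 7.16 (a)] -/
private theorem functional_eq_zero {s : Multiset (ZMod m)} (hs : IsHodgeMultiset s) (L : (ZMod m → ℚ) → ℚ)
    (hadd : ∀ g g' : ZMod m → ℚ, L (fun z ↦ g z + g' z) = L g + L g')
    (hmul : ∀ (c : ℚ) (g : ZMod m → ℚ), L (fun z ↦ c * g z) = c * L g)
    (hsum : ∀ {ι : Type} (t : Finset ι) (g : ι → ZMod m → ℚ), L (fun z ↦ ∑ j ∈ t, g j z) = ∑ j ∈ t, L (g j))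
    (heven : ∀ g : ZMod m → ℚ, (∀ z, g (-z) = g z) → L g = 0)
    (hko : ∀ M ∈ m.divisors, ∀ y : ZMod m, L (koVec m M y) = 0) :
    L (fun w ↦ (count w s : ℚ)) = 0 := by
  classical
  obtain ⟨cr, cd, hrep⟩ := Literature.NumberTheory.Transcendental.KoblitzOgus.hodge_eq_combination
    (N := m) (fun x ↦ (count x s : ℚ)) (fun u hu ↦ hs.sum_count_mul_bern_eq_zero hu)
  have hf : (fun w ↦ (count w s : ℚ)) =
      fun w ↦ (∑ a : ZMod m, cr a * ((if a = w then (1 : ℚ) else 0) + (if -a = w then 1 else 0))) +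
        ∑ M ∈ m.divisors, ∑ y : ZMod m, cd M y * koVec m M y w := funext hrep
  rw [hf, hadd, hsum, hsum]
  have hA : ∀ a : ZMod m, L (fun w ↦ cr a * ((if a = w then (1 : ℚ) else 0) + (if -a = w then 1 else 0))) = 0 :=
    fun a ↦ by
      rw [hmul, heven _ fun w ↦ ?_, mul_zero]
      rw [add_comm]
      congr 1
      · simp only [neg_inj]
      · simp only [eq_neg_iff_add_eq_zero, neg_eq_iff_add_eq_zero]
  have hB : ∀ M ∈ m.divisors, L (fun w ↦ ∑ y : ZMod m, cd M y * koVec m M y w) = 0 := fun M hM ↦ by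
    rw [hsum]
    refine Finset.sum_eq_zero fun y _ ↦ ?_
    rw [hmul, hko M hM y, mul_zero]
  rw [Finset.sum_eq_zero fun a _ ↦ hA a, Finset.sum_eq_zero hB, add_zero]

/-! ### Residues prime to the level -/

/-- `p ∣ ⟨−x⟩ ↔ p ∣ ⟨x⟩` for a divisor `p` of `m`. [folklore] -/
private theorem dvd_val_neg_iff' {p : ℕ} (hp : p ∣ m) (x : ZMod m) : p ∣ (-x).val ↔ p ∣ x.val := by
  rw [ZMod.neg_val]
  split_ifs with hx
  · rw [hx, ZMod.val_zero]
  · have hlt := (ZMod.val_lt x).le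
    constructor
    · intro h
      have h2 : p ∣ m - (m - x.val) := Nat.dvd_sub hp h
      rwa [Nat.sub_sub_self hlt] at h2
    · intro h
      exact Nat.dvd_sub hp h

/-- A residue prime to `m` has its negative prime to `m`. [folklore] -/
private theorem coprime_val_neg {x : ZMod m} (hx : Nat.Coprime x.val m) : Nat.Coprime (-x).val m := by
  rw [Nat.coprime_iff_gcd_eq_one] at hx ⊢
  by_contra h
  obtain ⟨p, hp, hpd⟩ := Nat.exists_prime_and_dvd h
  have hpm : p ∣ m := dvd_trans hpd (Nat.gcd_dvd_right _ _)
  have hpx : p ∣ (-x).val := dvd_trans hpd (Nat.gcd_dvd_left _ _)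
  rw [dvd_val_neg_iff' hpm] at hpx
  have : p ∣ Nat.gcd x.val m := Nat.dvd_gcd hpx hpm
  rw [hx] at this
  exact hp.one_lt.ne' (Nat.dvd_one.mp this)

/-- **The point `(m/M)·z` of a distribution vector of a proper level `M` is not prime to `m`**: its representative is
divisible by `m/M > 1`. [folklore] -/
private theorem point_ne_of_coprime {M : ℕ} (hM : M ∣ m) (hMlt : M < m) (z : ZMod m) {y : ZMod m} (hy : Nat.Coprime y.val m) :
    ((m / M : ℕ) : ZMod m) * z ≠ y := by
  have hm0 : 0 < m := NeZero.pos m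
  have hM0 : 0 < M := Nat.pos_of_dvd_of_pos hM hm0
  obtain ⟨c, hc⟩ := hM
  have hcm : m / M = c := by rw [hc, Nat.mul_div_cancel_left _ hM0]
  have hc1 : 1 < c := by
    by_contra h
    have : c ≤ 1 := by omega
    interval_cases c <;> simp_all
  have hcdvd : c ∣ m := ⟨M, by rw [hc, mul_comm]⟩
  intro h
  have hval : c ∣ y.val := by
    rw [← h, hcm, show (((c : ℕ)) : ZMod m) * z = (((c * z.val : ℕ)) : ZMod m) by push_cast; rw [ZMod.natCast_zmod_val],
      ZMod.val_natCast]
    exact (Nat.dvd_mod_iff hcdvd).mpr (Dvd.intro _ rfl)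
  have : c ∣ Nat.gcd y.val m := Nat.dvd_gcd hval hcdvd
  rw [Nat.Coprime.gcd_eq_one hy] at this
  exact absurd (Nat.le_of_dvd one_pos this) (by omega)

/-- Adding a residue whose representative is divisible by `M ∣ m` does not change the class mod `M`. [folklore] -/
private theorem mod_add_of_dvd' {M : ℕ} (hM : M ∣ m) (x : ZMod m) {c : ZMod m} (hc : M ∣ c.val) :
    (x + c).val % M = x.val % M := by
  obtain ⟨t, ht⟩ := hc
  rw [ZMod.val_add, Nat.mod_mod_of_dvd _ hM, ht, Nat.add_mul_mod_self_left]

/-- `M ∣ ⟨−c⟩` when `M ∣ ⟨c⟩` (`M ∣ m`). [folklore] -/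
private theorem dvd_val_neg_of_dvd {M : ℕ} (hM : M ∣ m) {c : ZMod m} (hc : M ∣ c.val) : M ∣ (-c).val :=
  (dvd_val_neg_iff' hM c).mpr hc

/-! ### The cube relation -/

/-- The vertex `y_A = y + Σ_{i ∈ A} δ_i` of the cube. [folklore] -/
private def vertex {k : ℕ} (y : ZMod m) (δ : Fin k → ZMod m) (A : Finset (Fin k)) : ZMod m := y + ∑ i ∈ A, δ i

/-- Toggling the index `i`: `A ↦ A ∖ {i}` if `i ∈ A`, else `A ∪ {i}`. [folklore] -/
private def toggle {k : ℕ} (i : Fin k) (A : Finset (Fin k)) : Finset (Fin k) := if i ∈ A then A.erase i else insert i A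

omit [NeZero m] in
/-- Toggling is an involution. [folklore] -/
private theorem toggle_toggle {k : ℕ} (i : Fin k) (A : Finset (Fin k)) : toggle i (toggle i A) = A := by
  unfold toggle
  split_ifs with h h' h'
  · exact absurd h' (Finset.notMem_erase i A)
  · exact Finset.insert_erase h
  · exact Finset.erase_insert h
  · exact absurd (Finset.mem_insert_self i A) h'

omit [NeZero m] in
/-- Toggling changes the set. [folklore] -/
private theorem toggle_ne {k : ℕ} (i : Fin k) (A : Finset (Fin k)) : toggle i A ≠ A := by
  unfold toggle
  split_ifs with h
  · exact fun e ↦ (Finset.notMem_erase i A) (e.symm ▸ h)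
  · exact fun e ↦ h (e ▸ Finset.mem_insert_self i A)

omit [NeZero m] in
/-- Toggling changes the parity of the cardinality: `(−1)^{#toggle A} = −(−1)^{#A}`. [folklore] -/
private theorem neg_one_pow_card_toggle {k : ℕ} (i : Fin k) (A : Finset (Fin k)) :
    ((-1 : ℚ)) ^ (toggle i A).card = -((-1 : ℚ)) ^ A.card := by
  unfold toggle
  split_ifs with h
  · have hc : A.card = (A.erase i).card + 1 := (Finset.card_erase_add_one h).symm
    rw [hc, pow_succ]; ring
  · rw [Finset.card_insert_of_notMem h, pow_succ]; ring

omit [NeZero m] in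
/-- The vertex of the toggled set differs by `±δ_i`: `y_{toggle A} = y_A + δ_i` (`i ∉ A`) or `y_A = y_{toggle A} + δ_i`
(`i ∈ A`). [folklore] -/
private theorem vertex_toggle {k : ℕ} (y : ZMod m) (δ : Fin k → ZMod m) (i : Fin k) (A : Finset (Fin k)) :
    (i ∉ A ∧ vertex y δ (toggle i A) = vertex y δ A + δ i) ∨ (i ∈ A ∧ vertex y δ A = vertex y δ (toggle i A) + δ i) := by
  unfold toggle vertex
  by_cases h : i ∈ A
  · right
    refine ⟨h, ?_⟩
    rw [if_pos h, ← Finset.add_sum_erase A δ h]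
    ring
  · left
    refine ⟨h, ?_⟩
    rw [if_neg h, Finset.sum_insert h]
    ring

/-- The cube relation with the covering hypothesis on all proper divisors (see `IsHodgeMultiset.cube_relation`).
[cite: Deligne1982HodgeCycles, Rem. 7.16 (a)] -/
private theorem cube_relation_aux {k : ℕ} {s : Multiset (ZMod m)} (hs : IsHodgeMultiset s) (y : ZMod m)
    (δ : Fin k → ZMod m) (hcover : ∀ M : ℕ, M ∣ m → M < m → ∃ i, M ∣ (δ i).val)
    (hunit : ∀ A : Finset (Fin k), Nat.Coprime (y + ∑ i ∈ A, δ i).val m) :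
    ∑ A : Finset (Fin k), (-1 : ℤ) ^ A.card *
      ((count (y + ∑ i ∈ A, δ i) s : ℤ) - count (-(y + ∑ i ∈ A, δ i)) s) = 0 := by
  classical
  -- the functional
  set L : (ZMod m → ℚ) → ℚ := fun g ↦ ∑ A : Finset (Fin k), (-1 : ℚ) ^ A.card * (g (vertex y δ A) - g (-(vertex y δ A)))
    with hL
  have key := functional_eq_zero hs L
    (fun g g' ↦ by simp only [hL, ← Finset.sum_add_distrib]; exact Finset.sum_congr rfl fun A _ ↦ by ring)
    (fun c g ↦ by simp only [hL, Finset.mul_sum]; exact Finset.sum_congr rfl fun A _ ↦ by ring)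
    (fun t g ↦ by
      simp only [hL]
      rw [Finset.sum_comm]
      exact Finset.sum_congr rfl fun A _ ↦ by rw [← Finset.sum_sub_distrib, Finset.mul_sum])
    (fun g hg ↦ by
      simp only [hL]
      exact Finset.sum_eq_zero fun A _ ↦ by rw [hg, sub_self, mul_zero])
    (fun M hM z ↦ by
      have hMdvd : M ∣ m := Nat.dvd_of_mem_divisors hM
      rcases (Nat.le_of_dvd (NeZero.pos m) hMdvd).lt_or_eq with hMlt | hMm
      · -- a proper divisor: the point part vanishes termwise, the congruence part cancels in pairs
        have hpt : ∀ A : Finset (Fin k), (if ((m / M : ℕ) : ZMod m) * z = vertex y δ A then (1 : ℚ) else 0) = 0 ∧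
            (if ((m / M : ℕ) : ZMod m) * z = -(vertex y δ A) then (1 : ℚ) else 0) = 0 := fun A ↦
          ⟨if_neg (point_ne_of_coprime hMdvd hMlt z (hunit A)),
            if_neg (point_ne_of_coprime hMdvd hMlt z (coprime_val_neg (hunit A)))⟩
        obtain ⟨i, hi⟩ := hcover M hMdvd hMlt
        simp only [hL, koVec]
        have e : ∀ A : Finset (Fin k), (-1 : ℚ) ^ A.card *
            (((if (vertex y δ A).val % M = z.val % M then (1 : ℚ) else 0) -
              (if ((m / M : ℕ) : ZMod m) * z = vertex y δ A then 1 else 0)) -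
             ((if (-(vertex y δ A)).val % M = z.val % M then (1 : ℚ) else 0) -
              (if ((m / M : ℕ) : ZMod m) * z = -(vertex y δ A) then 1 else 0))) =
            (-1 : ℚ) ^ A.card *
            ((if (vertex y δ A).val % M = z.val % M then (1 : ℚ) else 0) -
             (if (-(vertex y δ A)).val % M = z.val % M then (1 : ℚ) else 0)) := fun A ↦ by
          rw [(hpt A).1, (hpt A).2]; ring
        rw [Finset.sum_congr rfl fun A _ ↦ e A]
        -- cancel in pairs under `A ↦ toggle i A`
        refine Finset.sum_involution (fun A _ ↦ toggle i A) (fun A _ ↦ ?_) (fun A _ _ ↦ toggle_ne i A)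
          (fun A _ ↦ Finset.mem_univ _) (fun A _ ↦ toggle_toggle i A)
        have hcong : (vertex y δ (toggle i A)).val % M = (vertex y δ A).val % M ∧
            (-(vertex y δ (toggle i A))).val % M = (-(vertex y δ A)).val % M := by
          rcases vertex_toggle y δ i A with ⟨-, h⟩ | ⟨-, h⟩
          · rw [h, neg_add]
            exact ⟨mod_add_of_dvd' hMdvd _ hi, mod_add_of_dvd' hMdvd _ (dvd_val_neg_of_dvd hMdvd hi)⟩
          · rw [h, neg_add]
            exact ⟨(mod_add_of_dvd' hMdvd _ hi).symm, (mod_add_of_dvd' hMdvd _ (dvd_val_neg_of_dvd hMdvd hi)).symm⟩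
        rw [hcong.1, hcong.2, neg_one_pow_card_toggle]
        ring
      · -- `M = m`: the vector is zero
        subst hMm
        have hz : koVec M M z = fun _ ↦ 0 := by
          funext w
          simp only [koVec, Nat.mod_eq_of_lt (ZMod.val_lt _), Nat.div_self (NeZero.pos M), Nat.cast_one, one_mul]
          by_cases hzw : w = z
          · rw [if_pos (by rw [hzw]), if_pos hzw.symm, sub_self]
          · rw [if_neg (fun e ↦ hzw (ZMod.val_injective _ e)), if_neg (fun e ↦ hzw e.symm), sub_self]
        rw [hz]
        simp [hL])
  -- read the rational identity back in `ℤ`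
  simp only [hL, vertex] at key
  have cast : ((∑ A : Finset (Fin k), (-1 : ℤ) ^ A.card *
      ((count (y + ∑ i ∈ A, δ i) s : ℤ) - count (-(y + ∑ i ∈ A, δ i)) s) : ℤ) : ℚ) = 0 := by
    push_cast
    exact key
  exact_mod_cast cast

/-- Covering by primes: if for every prime `p ∣ m` some shift `δ_i` has representative divisible by `m/p`, then every proper
divisor `M` of `m` divides the representative of some `δ_i` (take a prime `p` of `m/M`; then `M ∣ m/p`). [folklore] -/
private theorem cover_of_primes {k : ℕ} (δ : Fin k → ZMod m) (h : ∀ p : ℕ, p.Prime → p ∣ m → ∃ i, (m / p) ∣ (δ i).val) :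
    ∀ M : ℕ, M ∣ m → M < m → ∃ i, M ∣ (δ i).val := by
  intro M hM hMlt
  have hm0 := NeZero.pos m
  obtain ⟨c, hc⟩ := hM
  have hM0 : 0 < M := Nat.pos_of_ne_zero fun h ↦ by rw [h, zero_mul] at hc; omega
  have hc1 : c ≠ 1 := fun h ↦ by rw [h, mul_one] at hc; omega
  obtain ⟨p, hp, hpc⟩ := Nat.exists_prime_and_dvd hc1
  have hpm : p ∣ m := dvd_trans hpc ⟨M, by rw [hc, mul_comm]⟩
  obtain ⟨i, hi⟩ := h p hp hpm
  refine ⟨i, dvd_trans ?_ hi⟩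
  obtain ⟨e, he⟩ := hpc
  refine ⟨e, ?_⟩
  rw [hc, he, show M * (p * e) = p * (M * e) by ring, Nat.mul_div_cancel_left _ hp.pos]

/-- **The cube relation.** Let `s` be a Hodge multiset over `ℤ/m`, `y ∈ ℤ/m`, and `δ₁, …, δ_k ∈ ℤ/m` shifts such that for every
prime `p ∣ m` some `δ_i` has representative divisible by `m/p` (`δ_i ∈ (m/p)ℤ`), and such that every vertex
`y_A = y + Σ_{i ∈ A} δ_i` (`A ⊆ {1, …, k}`) is prime to `m`. Then `Σ_A (−1)^{#A} (#_{y_A} s − #_{−y_A} s) = 0`. This formalisation's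
lemma from the Koblitz–Ogus span statement (`KoblitzOgus.hodge_eq_combination`): in [Aoki1983]'s terms the unit part `τ₁(α)` of
an element of `B_m` is annihilated by the primitive odd characters of conductor `m` ([Aoki1983, Prop. 2.2] at `d = 1`), and the
cube functions are annihilated by every imprimitive and every even character.
[cite: Deligne1982HodgeCycles, Rem. 7.16 (a)] [cite: Aoki1983, p. 28 (A(m), τ₁), Prop. 2.2] -/
theorem IsHodgeMultiset.cube_relation {k : ℕ} {s : Multiset (ZMod m)} (hs : IsHodgeMultiset s) (y : ZMod m)
    (δ : Fin k → ZMod m) (hcover : ∀ p : ℕ, p.Prime → p ∣ m → ∃ i, (m / p) ∣ (δ i).val)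
    (hunit : ∀ A : Finset (Fin k), Nat.Coprime (y + ∑ i ∈ A, δ i).val m) :
    ∑ A : Finset (Fin k), (-1 : ℤ) ^ A.card *
      ((count (y + ∑ i ∈ A, δ i) s : ℤ) - count (-(y + ∑ i ∈ A, δ i)) s) = 0 :=
  cube_relation_aux hs y δ (cover_of_primes δ hcover) hunit

/-- **The cube relation with two shifts** (`4` terms): for a Hodge multiset `s` over `ℤ/m` and `y, δ₁, δ₂` with `m/p` dividing
`⟨δ₁⟩` or `⟨δ₂⟩` for every prime `p ∣ m` and `y, y + δ₁, y + δ₂, y + δ₁ + δ₂` prime to `m`: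
`o(y) − o(y + δ₁) − o(y + δ₂) + o(y + δ₁ + δ₂) = 0`, `o(w) = #_w s − #_{−w} s`. (At `m = 2ᵃ3ᵇ`, `δ = (m/2, c·m/3)`: the class
relation of `Shioda1982.HodgeQuadruplesTwoThreePower`; at `m = 2ᵃp`: the one of `Shioda1982.PicardNumberTwoPowerPrime`.)
[cite: Deligne1982HodgeCycles, Rem. 7.16 (a)] [cite: Aoki1983, p. 28 (A(m), τ₁), Prop. 2.2] -/
theorem IsHodgeMultiset.cube_relation_two {s : Multiset (ZMod m)} (hs : IsHodgeMultiset s) (y δ₁ δ₂ : ZMod m)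
    (hcover : ∀ p : ℕ, p.Prime → p ∣ m → (m / p) ∣ δ₁.val ∨ (m / p) ∣ δ₂.val)
    (h00 : Nat.Coprime y.val m) (h10 : Nat.Coprime (y + δ₁).val m) (h01 : Nat.Coprime (y + δ₂).val m)
    (h11 : Nat.Coprime (y + δ₁ + δ₂).val m) :
    ((count y s : ℤ) - count (-y) s) - ((count (y + δ₁) s : ℤ) - count (-(y + δ₁)) s)
      - ((count (y + δ₂) s : ℤ) - count (-(y + δ₂)) s) + ((count (y + δ₁ + δ₂) s : ℤ) - count (-(y + δ₁ + δ₂)) s) = 0 := by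
  classical
  have h := hs.cube_relation y ![δ₁, δ₂]
    (fun p hp hpm ↦ by
      rcases hcover p hp hpm with h | h
      · exact ⟨0, by simpa using h⟩
      · exact ⟨1, by simpa using h⟩)
    (fun A ↦ by
      have hA : A ∈ (Finset.univ : Finset (Finset (Fin 2))) := Finset.mem_univ A
      have huniv : (Finset.univ : Finset (Finset (Fin 2))) = {∅, {0}, {1}, {0, 1}} := by decide
      rw [huniv] at hA
      simp only [Finset.mem_insert, Finset.mem_singleton] at hA
      rcases hA with rfl | rfl | rfl | rfl
      · simpa using h00
      · simpa using h10
      · simpa using h01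
      · simpa [add_assoc] using h11)
  have huniv : (Finset.univ : Finset (Finset (Fin 2))) = {∅, {0}, {1}, {0, 1}} := by decide
  rw [huniv, Finset.sum_insert (a := (∅ : Finset (Fin 2))) (by decide),
    Finset.sum_insert (a := ({0} : Finset (Fin 2))) (by decide), Finset.sum_insert (a := ({1} : Finset (Fin 2))) (by decide),
    Finset.sum_singleton (a := ({0, 1} : Finset (Fin 2)))] at h
  simp only [Finset.card_empty, pow_zero, one_mul, Finset.sum_empty, add_zero, Finset.card_singleton, pow_one,
    Finset.sum_singleton, Matrix.cons_val_zero, Matrix.cons_val_one] at h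
  rw [Finset.card_pair (by decide), Finset.sum_pair (by decide)] at h
  simp only [Matrix.cons_val_zero, Matrix.cons_val_one] at h
  rw [show y + δ₁ + δ₂ = y + (δ₁ + δ₂) from add_assoc _ _ _]
  linear_combination h

/-- **The cube relation with three shifts** (`8` terms): for a Hodge multiset `s` over `ℤ/m` and `y, δ₁, δ₂, δ₃` with `m/p`
dividing `⟨δ₁⟩`, `⟨δ₂⟩` or `⟨δ₃⟩` for every prime `p ∣ m` and all eight vertices `y + ε₁δ₁ + ε₂δ₂ + ε₃δ₃` prime to `m`:
`Σ_ε (−1)^{ε₁+ε₂+ε₃} o(y + ε₁δ₁ + ε₂δ₂ + ε₃δ₃) = 0`. (The levels `2ᵃ3ᵇ·5`, `2ᵃ3ᵇ·7`: `δ = (m/2, c₃·m/3, c₅·m/5)`.)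
[cite: Deligne1982HodgeCycles, Rem. 7.16 (a)] [cite: Aoki1983, p. 28 (A(m), τ₁), Prop. 2.2] -/
theorem IsHodgeMultiset.cube_relation_three {s : Multiset (ZMod m)} (hs : IsHodgeMultiset s) (y δ₁ δ₂ δ₃ : ZMod m)
    (hcover : ∀ p : ℕ, p.Prime → p ∣ m → (m / p) ∣ δ₁.val ∨ (m / p) ∣ δ₂.val ∨ (m / p) ∣ δ₃.val)
    (h000 : Nat.Coprime y.val m) (h100 : Nat.Coprime (y + δ₁).val m) (h010 : Nat.Coprime (y + δ₂).val m)
    (h110 : Nat.Coprime (y + δ₁ + δ₂).val m) (h001 : Nat.Coprime (y + δ₃).val m)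
    (h101 : Nat.Coprime (y + δ₁ + δ₃).val m) (h011 : Nat.Coprime (y + δ₂ + δ₃).val m)
    (h111 : Nat.Coprime (y + δ₁ + δ₂ + δ₃).val m) :
    (((count y s : ℤ) - count (-y) s) - ((count (y + δ₁) s : ℤ) - count (-(y + δ₁)) s)
      - ((count (y + δ₂) s : ℤ) - count (-(y + δ₂)) s) + ((count (y + δ₁ + δ₂) s : ℤ) - count (-(y + δ₁ + δ₂)) s))
    - (((count (y + δ₃) s : ℤ) - count (-(y + δ₃)) s) - ((count (y + δ₁ + δ₃) s : ℤ) - count (-(y + δ₁ + δ₃)) s)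
      - ((count (y + δ₂ + δ₃) s : ℤ) - count (-(y + δ₂ + δ₃)) s)
      + ((count (y + δ₁ + δ₂ + δ₃) s : ℤ) - count (-(y + δ₁ + δ₂ + δ₃)) s)) = 0 := by
  classical
  have h := hs.cube_relation y ![δ₁, δ₂, δ₃]
    (fun p hp hpm ↦ by
      rcases hcover p hp hpm with h | h | h
      · exact ⟨0, by simpa using h⟩
      · exact ⟨1, by simpa using h⟩
      · exact ⟨2, by simpa using h⟩)
    (fun A ↦ by
      have hA : A ∈ (Finset.univ : Finset (Finset (Fin 3))) := Finset.mem_univ A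
      have huniv : (Finset.univ : Finset (Finset (Fin 3))) =
          {∅, {0}, {1}, {0, 1}, {2}, {0, 2}, {1, 2}, {0, 1, 2}} := by decide
      rw [huniv] at hA
      simp only [Finset.mem_insert, Finset.mem_singleton] at hA
      rcases hA with rfl | rfl | rfl | rfl | rfl | rfl | rfl | rfl
      · simpa using h000
      · simpa using h100
      · simpa using h010
      · simpa [add_assoc] using h110
      · simpa using h001
      · simpa [add_assoc] using h101
      · simpa [add_assoc] using h011
      · simpa [add_assoc, Finset.sum_insert, Finset.sum_pair] using h111)
  have huniv : (Finset.univ : Finset (Finset (Fin 3))) = {∅, {0}, {1}, {0, 1}, {2}, {0, 2}, {1, 2}, {0, 1, 2}} := by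
    decide
  rw [huniv, Finset.sum_insert (a := (∅ : Finset (Fin 3))) (by decide),
    Finset.sum_insert (a := ({0} : Finset (Fin 3))) (by decide), Finset.sum_insert (a := ({1} : Finset (Fin 3))) (by decide),
    Finset.sum_insert (a := ({0, 1} : Finset (Fin 3))) (by decide), Finset.sum_insert (a := ({2} : Finset (Fin 3))) (by decide),
    Finset.sum_insert (a := ({0, 2} : Finset (Fin 3))) (by decide),
    Finset.sum_insert (a := ({1, 2} : Finset (Fin 3))) (by decide),
    Finset.sum_singleton (a := ({0, 1, 2} : Finset (Fin 3)))] at h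
  -- evaluate the cardinalities and the vertex sums of the non-trivial faces
  have c01 : Finset.card ({0, 1} : Finset (Fin 3)) = 2 := by decide
  have c02 : Finset.card ({0, 2} : Finset (Fin 3)) = 2 := by decide
  have c12 : Finset.card ({1, 2} : Finset (Fin 3)) = 2 := by decide
  have c8 : Finset.card ({0, 1, 2} : Finset (Fin 3)) = 3 := by decide
  have e01 : (∑ i ∈ ({0, 1} : Finset (Fin 3)), ![δ₁, δ₂, δ₃] i) = δ₁ + δ₂ := by
    rw [Finset.sum_pair (by decide)]; simp
  have e02 : (∑ i ∈ ({0, 2} : Finset (Fin 3)), ![δ₁, δ₂, δ₃] i) = δ₁ + δ₃ := by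
    rw [Finset.sum_pair (by decide)]; simp
  have e12 : (∑ i ∈ ({1, 2} : Finset (Fin 3)), ![δ₁, δ₂, δ₃] i) = δ₂ + δ₃ := by
    rw [Finset.sum_pair (by decide)]; simp
  have e8 : (∑ i ∈ ({0, 1, 2} : Finset (Fin 3)), ![δ₁, δ₂, δ₃] i) = δ₁ + δ₂ + δ₃ := by
    rw [Finset.sum_insert (by decide), Finset.sum_pair (by decide)]
    simp [add_assoc]
  rw [c01, c02, c12, c8, e01, e02, e12, e8] at h
  simp only [Finset.card_empty, pow_zero, one_mul, Finset.sum_empty, add_zero, Finset.card_singleton, pow_one,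
    Finset.sum_singleton, Matrix.cons_val_zero, Matrix.cons_val_one, Matrix.cons_val_two, Matrix.head_cons,
    Matrix.tail_cons] at h
  rw [show y + δ₁ + δ₂ = y + (δ₁ + δ₂) from add_assoc _ _ _, show y + δ₁ + δ₃ = y + (δ₁ + δ₃) from add_assoc _ _ _,
    show y + δ₂ + δ₃ = y + (δ₂ + δ₃) from add_assoc _ _ _,
    show y + (δ₁ + δ₂) + δ₃ = y + (δ₁ + δ₂ + δ₃) from add_assoc _ _ _]
  linear_combination h

end CubeRelations

end FermatCharacter

end Literature.AlgebraicGeometry.HodgeTheory
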